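import Mathlib
import Literature.NumberTheory.EllipticCurves.Greenberg1999.SelmerCotorsionMultiplicative
import Literature.NumberTheory.EllipticCurves.Greenberg1999.EulerCharacteristicNonsplitMultiplicativeAnyPrime
import Literature.NumberTheory.EllipticCurves.Greenberg1999.EulerCharacteristicSplitMultiplicativeAnyPrime
import Literature.NumberTheory.EllipticCurves.ModularCurve
import Literature.NumberTheory.EllipticCurves.Isogeny
import HarnessLib

/-!
# MultConverseCycPublishedInputsAtTwo

Topic `Literature/NumberTheory/EllipticCurves`. Named literature fact(s) relocated by the gate from `Summits/BirchSwinnertonDyer/BirchSwinnertonDyer/Theorems/TwoAdicConverseMultCycDefs.lean`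
(accept-time relocation of `[cite]`d propositions written inline in a Summits proposal; human ruling 2026-08-15).
Sources: BCDTJAMS2001, GreenbergLNM1716.

* `Literature.NumberTheory.EllipticCurves.MultCycPublishedInputsAtTwo`
-/

namespace Literature.NumberTheory.EllipticCurves

open scoped MatrixGroups ModularForm
open CongruenceSubgroup WeierstrassCurve Literature.NumberTheory.EllipticCurves

/-- **[proposed support child] The PUBLISHED inputs of the cyclotomic road to the rank-`0` `2`-converse at a
multiplicative `2`, as ONE conjunction of Literature named facts** (the `OrdConversePublishedInputsAtTwo` / EisensteinPrimes
`PublishedInputs` precedent): Greenberg, LNM 1716 §4 pp. 112–113 "the analogue of theorem 4.1" at a NON-SPLIT multiplicative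
prime, guarded form (`Greenberg1999.thm41Analogue_charValue_rankZero_numberField_anyPrime_oddLocalDegree`, p425330; audit
D-AUDIT-h41) ∧ the same at a SPLIT multiplicative prime (`…_split_baseChange_anyPrime`, A236, audit V3 PASS) ∧ modularity as
parametrisation data (BCDT 2001 Thm. A, `ModularForms.nonempty_modularParametrizationData`; it also supplies the rational period
ratio `ϖ = Ω⁺_f/Ω_E`) ∧ Greenberg's Thm. 1.5 (Kato–Rohrlich), LNM 1716 p. 61: `X(E/ℚ_∞)` is `Λ`-torsion at a multiplicative `p`,
every `p` (`Greenberg1999.thm15_isTorsion_multiplicative_rat`, p431724). Carried as displayed PUB hypotheses; never counted as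
progress. Kato's Cor. 14.3 at `2` / entire continuation (the route's existing child `MultConversePublishedInputsAtTwo`, item 19185)
are NOT repeated here. [cite: GreenbergLNM1716, §4 pp. 112–113 and Thm. 1.5 (p. 61)] [cite: BCDTJAMS2001, Thm. A]
[file NumberTheory/EllipticCurves/MultConverseCycPublishedInputsAtTwo.lean] -/
def MultCycPublishedInputsAtTwo : Prop :=
  Literature.NumberTheory.EllipticCurves.Greenberg1999.thm41Analogue_charValue_rankZero_numberField_anyPrime_oddLocalDegree ∧
    Literature.NumberTheory.EllipticCurves.Greenberg1999.thm41Analogue_charValue_rankZero_split_baseChange_anyPrime ∧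
      Literature.NumberTheory.EllipticCurves.ModularForms.nonempty_modularParametrizationData ∧
        Literature.NumberTheory.EllipticCurves.Greenberg1999.thm15_isTorsion_multiplicative_rat

end Literature.NumberTheory.EllipticCurves
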